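import Literature.Probability.RandomPlanarGeometry.HexSAWStripBetaCoefficientLaw
import Literature.Probability.RandomPlanarGeometry.HexSAWStripThresholdChainPointwise
import HarnessLib

/-!
# The renewal split of the β-walks of the honeycomb strip GRADED BY LENGTH, with the surface weights: an EXACT identity in the
# infinite strip, and the summability of its pieces at the threshold `y_T` (module «BETA-LENGTH-SPLIT»)

Topic `Literature/Probability/RandomPlanarGeometry` (continues «BETA-SPLIT» `HexSAWStripBetaRenewalSplit.lean` — the three-piece renewal split
`HV.fstP / HV.midPc / HV.tailPc` of a β-walk with a renewal index, `HV.threePieces_injOn`, `HV.glue3_spec`, `HV.glue3_mem_renA`, the classes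
`HV.headN / HV.HB0 / HV.tailN`, `HV.renA`, the type bookkeeping `HV.T3 / HV.rtypes`; «BETA-COEFF» `HexSAWStripBetaCoefficientLaw.lean` — the truncated
piece series `HV.headGFN / HV.tailGFN`, bounded at `y_T` (`HV.exists_headGFN_stripYT_le`, `HV.exists_tailGFN_stripYT_le`), the explicit members
`HV.sq_le_headGFN_one`, `HV.mul_le_tailGFN_top`; «BETA-NORENEWAL» (`HV.noRenA`, `HV.exists_sum_noRenA_stripYT_le`); `HexSAWStripThresholdChainPointwise.lean`
(`HV.betaLen`, `HV.sum_caseB_len_le`); «LENGTH-POINTWISE» `HexSAWStripBridgeLengthPointwise.lean` (`HV.LUset / HV.LUs / HV.LUM`, `HV.exists_LUs_stripYT_le`)).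
Sources of the SETTING: H. Duminil-Copin, A. Hammond, CMP 324 (2013) §2.2 (bridges, renewal points, concatenation and unique decomposition —
here along the column `ξ` of the width-`T` honeycomb strip); H. Duminil-Copin, S. Smirnov, Ann. Math. 175 (2012) §3 (the domains `S_{T,L}`, walks
`a → β`, the symmetry of `S_{T,L}`); N. R. Beaton, M. Bousquet-Mélou, J. de Gier, H. Duminil-Copin, A. J. Guttmann, CMP 326 (2014), arXiv:1109.0358v5,
§3.2 (`B_T(x; y) = Σ_ω x^{|ω|} y^{#contacts}`, Corollary 8: the radius `y_T` of `B_T(x_c; ·)`).  None of the sources writes the split; the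
statements are the lane's own (lane «pcv-sawmu», CriticalPhenomena venture, a-p2 g22) — the combinatorial and the summability halves of the
POINTWISE LAW OF THE β-WALKS BY LENGTH at `y_T` (next module «BETA-LENGTH-LAW»), item 1 of HANDOFF a-p2 g21.

«BETA-SPLIT» grades the split by the number of surface CONTACTS with pure `x_c^{|ω|}` weights (the coefficients `β_{T,L,m}`); here the SAME
bijection is graded by the number of VERTICES with the full weights `x_c^{|ω|} y^{#top(ω)}` — lengths and contacts are both additive over the
three pieces (`HV.length_topCnt_threePieces`).  Since a walk with `n` vertices and its pieces fit in every class truncated at `N + 1 ≥ n` and in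
every box `S_{T,L}` with `L + 1 ≥ n`, all slices STABILISE and the two split inequalities close up to an exact identity in the infinite strip.

## What is proved (namespace `Literature.Probability.RandomPlanarGeometry.SAW.HV`; `x_c = hexCriticalFugacity`, `y_T = stripYT T`)

* §1 the `y`-weighted length slices `headLenN` (`fℓ^{(N)}_c(i)`: heads with `i` vertices), `hb0LenN` (`dℓ^{(N)}_{ce}(j)`: middle bridges with `j`
  steps, the trivial one at `j = 0`), `tailLenN` (`gℓ^{(N)}_e(k)`); the length type `ltype`, `renALen`, `tripleW`; ★ `weight_eq_tripleW_threePieces`;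
  ★ `renALen_le_prod` (upper, `i + j + k ≤ N + 1`) and ★ `prod_le_renALen` (lower, `2N + N' ≤ L`), length type by length type.
* §2 `ltype_mem_rtypes`, ★ `sum_renA_len_eq_sum_rtypes` (fibre decomposition), `sum_caseA_len_le_caseB` (mirror), ★ `sum_betaLen_eq_two_mul_caseA`,
  `sum_caseA_len_eq`, `betaRenewalLenN`; ★★ `sum_betaLen_le_renewal` (`n ≤ N + 1`) and ★★ `renewal_le_sum_betaLen` (`2N + N' ≤ L`):
  `Σ_{betaLen T L n} x_c^{|ω|} y^{#top} ≶ 2·( Σ_{N₀^A, |ω| = n} + Σ_{c,e} Σ_{i+j+k=n} fℓ^{(N)}_c(i) dℓ^{(N')}_{ce}(j) gℓ^{(N)}_e(k) )` (every `T ≥ 1`, `y ≥ 0`).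
* §3 stabilisation: `filter_headN_length_eq_of_le`, `filter_tailN_length_eq_of_le`, `filter_HB0_length_eq_of_le`, `betaLen_eq_of_le`,
  `filter_noRenA_length_eq_of_le`; the pieces of the INFINITE strip `headLen` (`fℓ_c(i)`), `hb0Len` (`dℓ_{ce}(j)`), `tailLen` (`gℓ_e(k)`) and
  `headLenN_eq_headLen` …; the walks of the infinite strip `betaLenSum` (`bℓ_T(n)(y) = Σ_{β-walks, n vertices} x_c^{n} y^{#top}`), `noRenLen` (`nℓ_T(n)`),
  `betaRenewalLen`; `sum_betaLen_eq_betaLenSum` (every box `L ≥ n`); ★★★ `betaLenSum_eq_two_mul` — THE EXACT SPLIT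
  `bℓ_T(n)(y) = 2·( nℓ_T(n)(y) + Σ_{a,b} Σ_{i+j+k=n} fℓ_a(i) dℓ_{ab}(j) gℓ_b(k) )` for all `n`, `y ≥ 0`, `T ≥ 1`.
* §4 ★ `hb0Len_eq_LUs` / `hb0Len_eq_LUM` — for `j ≥ 1` the middle slices ARE the length slices `U_j = LUM T j j` of the bridge files;
  `hb0Len_zero_le`; ★ `exists_hb0Len_stripYT_le` — `dℓ_{ab}(j)(y_T) ≤ K` uniformly in `j` (`T ≥ 1`).
* §5 at `y_T`, `T ≥ 2`: `sum_range_headLen_eq_headGFN` (`Σ_{i ≤ N+1} fℓ_c(i) = F^{(N)}_c`), `sum_range_tailLen_eq_tailGFN`, `sum_range_noRenLen_le`;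
  ★★ `summable_headLen`, ★★ `summable_tailLen`, ★★ `summable_noRenLen` and `tendsto_noRenLen_atTop` (`nℓ_T(n)(y_T) → 0`); the series
  `headLenGF` (`Fℓ_c = Σ_i fℓ_c(i)(y_T)`), `tailLenGF` (`Gℓ_e`) with ★ `tendsto_headGFN_headLenGF` (`F^{(N)}_c(y_T) → Fℓ_c`), `tendsto_tailGFN_tailLenGF`,
  `headGFN_le_headLenGF`, ★ `headLenGF_one_pos` (`Fℓ_1 > 0`, `Gℓ_{2T−2} > 0`).
NOT claimed here: the limit law itself (next module), parities of the slices, `T = 1` for §5, uniformity in `T`.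
-/

noncomputable section

open Finset Filter Topology Literature.Probability.LatticeModels Literature.Probability.Percolation

namespace Literature.Probability.RandomPlanarGeometry.SAW

namespace HV

variable {T : ℕ}

/-! ### §1 The length-graded, `y`-weighted piece sums and the length type of a β-walk -/

section Pieces

/-- `fℓ^{(N)}_c(i)(y) = Σ x_c^{|h|} y^{#top(h)}` over the heads `h ∈ headN T N c` with exactly `i` vertices (the `y`-weighted head
pieces of the renewal split of the β-walks, graded by LENGTH). [cite: DuminilCopinHammond2013, §2.2 (renewal points); BeatonBousquetMelouDeGierDuminilCopinGuttmann2014, §3.2 (weights x^{|ω|} y^{#contacts}); lane «pcv-sawmu» a-p2 g22] -/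
def headLenN (T N i : ℕ) (c : ℤ) (y : ℝ) : ℝ :=
  ∑ h ∈ (headN T N c).filter (fun h => h.length = i), hexCriticalFugacity ^ h.length * y ^ topCnt T h

/-- `dℓ^{(N)}_{ce}(j)(y) = Σ x_c^{|b|−1} y^{#top(b.tail)}` over the middle pieces `b ∈ HB0 T N c e` with exactly `j` steps (`j + 1` vertices; the
trivial bridge is `j = 0`). [cite: DuminilCopinHammond2013, §2.2 (bridges); BeatonBousquetMelouDeGierDuminilCopinGuttmann2014, §3.2; lane «pcv-sawmu» a-p2 g22] -/
def hb0LenN (T N j : ℕ) (c e : ℤ) (y : ℝ) : ℝ :=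
  ∑ b ∈ (HB0 T N c e).filter (fun b => b.length = j + 1), wD T y b

/-- `gℓ^{(N)}_e(k)(y) = Σ x_c^{|g|−1} y^{#top(g.tail)}` over the tails `g ∈ tailN T N e` with exactly `k` steps.
[cite: DuminilCopinHammond2013, §2.2; BeatonBousquetMelouDeGierDuminilCopinGuttmann2014, §3.2; lane «pcv-sawmu» a-p2 g22] -/
def tailLenN (T N k : ℕ) (e : ℤ) (y : ℝ) : ℝ :=
  ∑ g ∈ (tailN T N e).filter (fun g => g.length = k + 1), wD T y g

/-- The LENGTH TYPE of a walk with a renewal index: (level of the first renewal vertex, level of the last renewal vertex, number of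
vertices of the head, number of steps of the middle bridge, number of steps of the tail). [cite: DuminilCopinHammond2013, §2.2; lane plumbing] -/
def ltype (l : List HV) : ℤ × ℤ × ℕ × ℕ × ℕ :=
  (ltLev (fstP l), hdLev (tailPc l), (fstP l).length, (midPc l).length - 1, (tailPc l).length - 1)

/-- `aℓ_L(θ)(y) = Σ x_c^{|ω|} y^{#top(ω)}` over the β-walks of `S_{T,L}` with a renewal index and length type `θ`.
[cite: BeatonBousquetMelouDeGierDuminilCopinGuttmann2014, §3.2; lane «pcv-sawmu» a-p2 g22] -/
def renALen (T L : ℕ) (y : ℝ) (θ : ℤ × ℤ × ℕ × ℕ × ℕ) : ℝ :=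
  ∑ l ∈ (renA T L).filter (fun l => ltype l = θ), hexCriticalFugacity ^ l.length * y ^ topCnt T l

/-- The `y`-weight of a triple (head, middle, tail): `x_c^{|h|} y^{#top h} · wD(b) · wD(g)` (plumbing). [folklore] -/
def tripleW (T : ℕ) (y : ℝ) (t : List HV × List HV × List HV) : ℝ :=
  hexCriticalFugacity ^ t.1.length * y ^ topCnt T t.1 * (wD T y t.2.1 * wD T y t.2.2)

variable {N N' L : ℕ} {y : ℝ}

/-- `tripleW ≥ 0` for `y ≥ 0` (plumbing). [cite: DuminilCopinHammond2013, §2.2; lane plumbing] -/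
theorem tripleW_nonneg (T : ℕ) (hy : 0 ≤ y) (t : List HV × List HV × List HV) : 0 ≤ tripleW T y t :=
  mul_nonneg (mul_nonneg (pow_nonneg hexCriticalFugacity_pos_lt_one.1.le _) (pow_nonneg hy _))
    (mul_nonneg (wD_nonneg T hy _) (wD_nonneg T hy _))

/-- The product of three class sums is the sum of `tripleW` over the product class (plumbing). [cite: DuminilCopinHammond2013, §2.2; lane plumbing] -/
theorem prod_sum_eq_sum_tripleW (A B C : Finset (List HV)) :
    (∑ h ∈ A, hexCriticalFugacity ^ h.length * y ^ topCnt T h) * (∑ b ∈ B, wD T y b) * (∑ g ∈ C, wD T y g) =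
      ∑ t ∈ A ×ˢ (B ×ˢ C), tripleW T y t := by
  rw [mul_assoc, sum_mul_sum B C, sum_mul_sum A B, sum_product]
  refine sum_congr rfl fun h _ => ?_
  rw [sum_product]
  refine sum_congr rfl fun b _ => ?_
  rw [mul_sum]
  refine sum_congr rfl fun g _ => ?_
  simp only [tripleW]

/-- The weight of a β-walk with a renewal index is the `tripleW` of its three pieces. [cite: BeatonBousquetMelouDeGierDuminilCopinGuttmann2014, §3.2 (weights x^{|ω|} y^{#contacts} are multiplicative); lane plumbing] -/
theorem weight_eq_tripleW_threePieces {l : List HV} (hne : (renIdxs l).Nonempty) (T : ℕ) (y : ℝ) :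
    hexCriticalFugacity ^ l.length * y ^ topCnt T l = tripleW T y (fstP l, midPc l, tailPc l) := by
  obtain ⟨h1, h2⟩ := length_topCnt_threePieces hne T
  simp only [tripleW, wD]
  rw [h1, h2, pow_add, pow_add, pow_add, pow_add]
  ring

/-- ★ **Upper inequality, length type by length type**: a β-walk of `S_{T,L}` with a renewal index and length type `(c,e,i,j,k)` has
`i + j + k` vertices and splits injectively into a head with `i` vertices, a middle bridge with `j` steps and a tail with `k` steps of the
classes truncated at any `N` with `i + j + k ≤ N + 1`; weights multiply: `aℓ_L(c,e,i,j,k) ≤ fℓ^{(N)}_c(i) · dℓ^{(N)}_{ce}(j) · gℓ^{(N)}_e(k)`.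
[cite: DuminilCopinHammond2013, §2.2; BeatonBousquetMelouDeGierDuminilCopinGuttmann2014, §3.2; lane «pcv-sawmu» a-p2 g22 — own] -/
theorem renALen_le_prod (hT : 1 ≤ T) (hy : 0 ≤ y) (c e : ℤ) {i j k : ℕ} (hN : i + j + k ≤ N + 1) :
    renALen T L y (c, e, i, j, k) ≤ headLenN T N i c y * hb0LenN T N j c e y * tailLenN T N k e y := by
  classical
  set F := (renA T L).filter (fun l => ltype l = (c, e, i, j, k)) with hF
  have hmem : ∀ l ∈ F, l ∈ renA T L ∧ (renIdxs l).Nonempty ∧ l.length ≤ N + 1 ∧ ltype l = (c, e, i, j, k) := by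
    intro l hl
    rw [hF, mem_filter] at hl
    have h1 := hl.1
    rw [renA, mem_filter] at h1
    have hlen := (length_topCnt_threePieces h1.2 T).1
    have htyp := hl.2
    simp only [ltype, Prod.mk.injEq] at htyp
    exact ⟨hl.1, h1.2, by omega, hl.2⟩
  rw [headLenN, hb0LenN, tailLenN, prod_sum_eq_sum_tripleW, renALen, ← hF]
  calc ∑ l ∈ F, hexCriticalFugacity ^ l.length * y ^ topCnt T l = ∑ l ∈ F, tripleW T y (fstP l, midPc l, tailPc l) :=
        sum_congr rfl fun l hl => weight_eq_tripleW_threePieces (hmem l hl).2.1 T y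
    _ = ∑ t ∈ F.image (fun l => (fstP l, midPc l, tailPc l)), tripleW T y t := by
        rw [sum_image]
        intro l hl l' hl' heq
        exact threePieces_injOn (hmem l hl).2.1 (hmem l' hl').2.1 heq
    _ ≤ _ := by
        refine sum_le_sum_of_subset_of_nonneg (fun t ht => ?_) fun t _ _ => tripleW_nonneg T hy t
        rw [mem_image] at ht
        obtain ⟨l, hl, rfl⟩ := ht
        obtain ⟨hren, hne, hlen, htyp⟩ := hmem l hl
        simp only [ltype, Prod.mk.injEq] at htyp
        obtain ⟨h1, h2, h3, h4, h5⟩ := htyp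
        obtain ⟨hl1, hl2, -⟩ := threePieces_levels hne
        obtain ⟨hf0, hfl, hl1', hlen1, hlen2, hlen3⟩ := threePieces_lengths hne
        rw [mem_product, mem_product, mem_filter, mem_filter, mem_filter]
        dsimp only
        refine ⟨⟨?_, h3⟩, ⟨?_, by omega⟩, ⟨?_, by omega⟩⟩
        · rw [← h1]; exact fstP_mem_headN hT hren hlen
        · rw [← h1, ← h2, hl1, ← hl2]; exact midPc_mem_HB0 hT hren hlen
        · rw [← h2]; exact tailPc_mem_tailN hT hren hlen

/-- ★ **Lower inequality, length type by length type**: gluing is injective on `headN T N c × HB0 T N' c e × tailN T N e` and lands in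
the β-walks of `S_{T,L}` with a renewal index and the corresponding length type whenever `2N + N' ≤ L`:
`fℓ^{(N)}_c(i) · dℓ^{(N')}_{ce}(j) · gℓ^{(N)}_e(k) ≤ aℓ_L(c,e,i,j,k)` (`y ≥ 0`).
[cite: DuminilCopinHammond2013, §2.2; BeatonBousquetMelouDeGierDuminilCopinGuttmann2014, §3.2; lane «pcv-sawmu» a-p2 g22 — own] -/
theorem prod_le_renALen (hT : 1 ≤ T) (hy : 0 ≤ y) (hL : 2 * N + N' ≤ L) (c e : ℤ) (i j k : ℕ) :
    headLenN T N i c y * hb0LenN T N' j c e y * tailLenN T N k e y ≤ renALen T L y (c, e, i, j, k) := by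
  classical
  have hx := hexCriticalFugacity_pos_lt_one
  set A := (headN T N c).filter (fun h => h.length = i) with hA
  set B := (HB0 T N' c e).filter (fun b => b.length = j + 1) with hB
  set C := (tailN T N e).filter (fun g => g.length = k + 1) with hC
  have hmem : ∀ t ∈ A ×ˢ (B ×ˢ C), t.1 ∈ headN T N c ∧ t.2.1 ∈ HB0 T N' c e ∧ t.2.2 ∈ tailN T N e ∧
      t.1.length = i ∧ t.2.1.length = j + 1 ∧ t.2.2.length = k + 1 := by
    intro t ht
    rw [mem_product, mem_product, hA, hB, hC, mem_filter, mem_filter, mem_filter] at ht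
    exact ⟨ht.1.1, ht.2.1.1, ht.2.2.1, ht.1.2, ht.2.1.2, ht.2.2.2⟩
  rw [headLenN, hb0LenN, tailLenN, prod_sum_eq_sum_tripleW, ← hA, ← hB, ← hC, renALen]
  calc ∑ t ∈ A ×ˢ (B ×ˢ C), tripleW T y t
      = ∑ t ∈ A ×ˢ (B ×ˢ C), hexCriticalFugacity ^ (glue3 t.1 t.2.1 t.2.2).length * y ^ topCnt T (glue3 t.1 t.2.1 t.2.2) := by
        refine sum_congr rfl fun t ht => ?_
        obtain ⟨h1, h2, h3, -⟩ := hmem t ht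
        obtain ⟨-, -, -, -, -, -, hrne, e1, e2, e3⟩ := glue3_spec h1 h2 h3
        rw [weight_eq_tripleW_threePieces hrne T y, e1, e2, e3]
    _ = ∑ l ∈ (A ×ˢ (B ×ˢ C)).image (fun t => glue3 t.1 t.2.1 t.2.2), hexCriticalFugacity ^ l.length * y ^ topCnt T l := by
        rw [sum_image]
        rintro ⟨th, tb, tg⟩ ht ⟨th', tb', tg'⟩ ht' heq
        obtain ⟨h1, h2, h3, -⟩ := hmem _ ht
        obtain ⟨h1', h2', h3', -⟩ := hmem _ ht'
        obtain ⟨-, -, -, -, -, -, -, e1, e2, e3⟩ := glue3_spec h1 h2 h3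
        obtain ⟨-, -, -, -, -, -, -, e1', e2', e3'⟩ := glue3_spec h1' h2' h3'
        simp only at heq e1 e2 e3 e1' e2' e3'
        rw [heq] at e1 e2 e3
        rw [← e1, ← e2, ← e3, e1', e2', e3']
    _ ≤ _ := by
        refine sum_le_sum_of_subset_of_nonneg (fun l hl => ?_) fun l _ _ => mul_nonneg (pow_nonneg hx.1.le _) (pow_nonneg hy _)
        rw [mem_image] at hl
        obtain ⟨t, ht, rfl⟩ := hl
        obtain ⟨h1, h2, h3, ti, tj, tk⟩ := hmem t ht
        obtain ⟨-, -, -, -, -, -, -, e1, e2, e3⟩ := glue3_spec h1 h2 h3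
        obtain ⟨-, -, -, -, -, -, -, -, hc1, -⟩ := of_mem_headN h1
        obtain ⟨-, -, -, -, -, -, -, -, he3, -⟩ := of_mem_tailN h3
        rw [mem_filter]
        refine ⟨glue3_mem_renA hT h1 h2 h3 hL, ?_⟩
        simp only [ltype, e1, e2, e3, hc1, he3, ti, tj, tk, Nat.add_sub_cancel]

end Pieces

/-! ### §2 Summing over length types: the `y`-weighted β-walks of `S_{T,L}` with `n` vertices against the renewal split -/

section Summed

variable {L N N' : ℕ} {y : ℝ}

/-- The length type of a β-walk with a renewal index lies in `rtypes T |ω|` (levels in `[0, 2T−1]`, `i + j + k = |ω|`); the type determines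
the length. [cite: DuminilCopinHammond2013, §2.2; lane plumbing] -/
theorem ltype_mem_rtypes (hT : 1 ≤ T) {l : List HV} (hl : l ∈ renA T L) :
    ltype l ∈ rtypes T l.length ∧ l.length = (ltype l).2.2.1 + (ltype l).2.2.2.1 + (ltype l).2.2.2.2 := by
  obtain ⟨-, -, -, -, -, -, hne, -⟩ := of_mem_renA hT hl
  have hr := (rtype_mem_rtypes hT hl).1
  rw [rtypes, rtype, mem_product, mem_product] at hr
  obtain ⟨hc, he, -⟩ := hr
  have hlen := (length_topCnt_threePieces hne T).1
  refine ⟨?_, by simp only [ltype]; exact hlen⟩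
  rw [rtypes, ltype, mem_product, mem_product, mem_T3]
  exact ⟨hc, he, hlen.symm⟩

/-- ★ **Fibre decomposition by length type**: the `x_c^{|ω|} y^{#top}`-weight of the β-walks of `S_{T,L}` with a renewal index and `n`
vertices is the sum over the length types of `aℓ_L(θ)`. [cite: DuminilCopinHammond2013, §2.2; BeatonBousquetMelouDeGierDuminilCopinGuttmann2014, §3.2; lane plumbing] -/
theorem sum_renA_len_eq_sum_rtypes (hT : 1 ≤ T) (L n : ℕ) (y : ℝ) :
    ∑ l ∈ (renA T L).filter (fun l => l.length = n), hexCriticalFugacity ^ l.length * y ^ topCnt T l =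
      ∑ θ ∈ rtypes T n, renALen T L y θ := by
  classical
  rw [← Finset.sum_fiberwise_of_maps_to (g := ltype) (t := rtypes T n) (fun l hl => by
    rw [mem_filter] at hl
    rw [← hl.2]; exact (ltype_mem_rtypes hT hl.1).1)]
  refine sum_congr rfl fun θ hθ => ?_
  rw [renALen, filter_filter]
  refine sum_congr (filter_congr fun l hl => ⟨fun h => h.2, fun h => ⟨?_, h⟩⟩) fun _ _ => rfl
  have h2 := (ltype_mem_rtypes hT hl).2
  rw [h] at h2
  rw [rtypes, mem_product, mem_product, mem_T3] at hθ
  omega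

/-- Case A of length `n` weighs at most case B of length `n` (the mirror in the vertical axis, an involution of the β-walks of `S_{T,L}`
exchanging the cases, keeps lengths and contacts). [cite: DuminilCopinSmirnov2012, §3 (Fig. 3: symmetry of S_{T,L}); lane plumbing] -/
theorem sum_caseA_len_le_caseB (hT : 1 ≤ T) (hy : 0 ≤ y) (n : ℕ) :
    ∑ l ∈ (caseA T L).filter (fun l => l.length = n), hexCriticalFugacity ^ l.length * y ^ topCnt T l ≤
      ∑ l ∈ (caseB T L).filter (fun l => l.length = n), hexCriticalFugacity ^ l.length * y ^ topCnt T l := by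
  classical
  have hinj : Set.InjOn (fun l : List HV => l.map mirrorX) ((caseA T L).filter (fun l => l.length = n) : Set (List HV)) :=
    fun l _ l' _ h => (List.map_injective_iff.2 mirrorX.injective) h
  calc ∑ l ∈ (caseA T L).filter (fun l => l.length = n), hexCriticalFugacity ^ l.length * y ^ topCnt T l
      = ∑ l ∈ (caseA T L).filter (fun l => l.length = n),
          hexCriticalFugacity ^ (l.map mirrorX).length * y ^ topCnt T (l.map mirrorX) :=
        sum_congr rfl fun l _ => by rw [List.length_map, topCnt_map_mirrorX]
    _ ≤ ∑ l ∈ (caseB T L).filter (fun l => l.length = n), hexCriticalFugacity ^ l.length * y ^ topCnt T l := by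
        refine sum_le_sum_of_injOn_of_nonneg (fun l : List HV => l.map mirrorX) hinj (fun l hl => ?_)
          (fun l : List HV => hexCriticalFugacity ^ l.length * y ^ topCnt T l)
          fun l _ => mul_nonneg (pow_nonneg hexCriticalFugacity_pos_lt_one.1.le _) (pow_nonneg hy _)
        rw [mem_filter, caseA, mem_filter] at hl
        rw [mem_filter, caseB, mem_filter, sIdx_map_mirrorX, tIdx_map_mirrorX, List.length_map]
        exact ⟨⟨map_mirrorX_mem_bridgeLists hT hl.1.1, hl.1.2⟩, hl.2⟩

/-- ★ The β-walks of `S_{T,L}` with `n` vertices weigh exactly twice their case-A half: `Σ_{betaLen T L n} x_c^{|ω|} y^{#top} = 2·Σ_{case A, n vertices}`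
(`y ≥ 0`, `T ≥ 1`). [cite: DuminilCopinSmirnov2012, §3 (symmetry of S_{T,L}); BeatonBousquetMelouDeGierDuminilCopinGuttmann2014, §3.2; lane plumbing] -/
theorem sum_betaLen_eq_two_mul_caseA (hT : 1 ≤ T) (hy : 0 ≤ y) (L n : ℕ) :
    ∑ l ∈ betaLen T L n, hexCriticalFugacity ^ l.length * y ^ topCnt T l =
      2 * ∑ l ∈ (caseA T L).filter (fun l => l.length = n), hexCriticalFugacity ^ l.length * y ^ topCnt T l := by
  classical
  rw [betaLen, bridgeLists_eq_caseA_union_caseB hT, filter_union]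
  have hdisj : Disjoint ((caseA T L).filter (fun l => l.length = n)) ((caseB T L).filter (fun l => l.length = n)) := by
    rw [disjoint_left]
    intro l h1 h2
    rw [mem_filter, caseA, mem_filter] at h1
    rw [mem_filter, caseB, mem_filter] at h2
    omega
  rw [sum_union hdisj]
  have h1 := sum_caseA_len_le_caseB hT hy n (T := T) (L := L)
  have h2 := sum_caseB_len_le hT hy n (T := T) (L := L)
  linarith

/-- Case A of length `n` splits into the walks without and with a renewal index. [cite: DuminilCopinHammond2013, §2.2; lane plumbing] -/
theorem sum_caseA_len_eq (L n : ℕ) (y : ℝ) :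
    ∑ l ∈ (caseA T L).filter (fun l => l.length = n), hexCriticalFugacity ^ l.length * y ^ topCnt T l =
      ∑ l ∈ (noRenA T L).filter (fun l => l.length = n), hexCriticalFugacity ^ l.length * y ^ topCnt T l +
      ∑ l ∈ (renA T L).filter (fun l => l.length = n), hexCriticalFugacity ^ l.length * y ^ topCnt T l := by
  classical
  rw [noRenA, renA_eq_filter_caseA, filter_filter, filter_filter, ← sum_union]
  · refine sum_congr ?_ fun _ _ => rfl
    ext l
    simp only [mem_filter, mem_union]
    constructor
    · rintro ⟨hl, hm⟩
      by_cases h : renIdxs l = ∅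
      · exact Or.inl ⟨hl, h, hm⟩
      · exact Or.inr ⟨hl, Finset.nonempty_iff_ne_empty.2 h, hm⟩
    · rintro (⟨hl, -, hm⟩ | ⟨hl, -, hm⟩) <;> exact ⟨hl, hm⟩
  · rw [disjoint_left]
    intro l h1 h2
    rw [mem_filter] at h1 h2
    exact Finset.nonempty_iff_ne_empty.1 h2.2.1 h1.2.1

/-- The truncated, `y`-weighted renewal sum at length `n`: `Σ_{c,e} Σ_{i+j+k=n} fℓ^{(N)}_c(i) dℓ^{(N')}_{ce}(j) gℓ^{(N)}_e(k)` (levels as integers in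
`[0, 2T−1]`; plumbing). [cite: DuminilCopinHammond2013, §2.2; lane plumbing] -/
def betaRenewalLenN (T N N' n : ℕ) (y : ℝ) : ℝ :=
  ∑ c ∈ Finset.Icc (0 : ℤ) (2 * T - 1), ∑ e ∈ Finset.Icc (0 : ℤ) (2 * T - 1), ∑ t ∈ T3 n,
    headLenN T N t.1 c y * hb0LenN T N' t.2.1 c e y * tailLenN T N t.2.2 e y

/-- `betaRenewalLenN` as a sum over `rtypes` (plumbing). [cite: DuminilCopinHammond2013, §2.2; lane plumbing] -/
theorem betaRenewalLenN_eq_sum_rtypes (N N' n : ℕ) (y : ℝ) :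
    betaRenewalLenN T N N' n y = ∑ θ ∈ rtypes T n, headLenN T N θ.2.2.1 θ.1 y * hb0LenN T N' θ.2.2.2.1 θ.1 θ.2.1 y * tailLenN T N θ.2.2.2.2 θ.2.1 y := by
  rw [betaRenewalLenN, rtypes, sum_product]
  refine sum_congr rfl fun c _ => ?_
  rw [sum_product]

/-- ★★ **THE LENGTH-GRADED RENEWAL SPLIT, UPPER HALF**: for `n ≤ N + 1`,
`Σ_{betaLen T L n} x_c^{|ω|} y^{#top(ω)} ≤ 2·( Σ_{ω ∈ N₀^A(S_{T,L}), |ω| = n} x_c^{|ω|} y^{#top(ω)} + Σ_{c,e} Σ_{i+j+k=n} fℓ^{(N)}_c(i) dℓ^{(N)}_{ce}(j) gℓ^{(N)}_e(k) )`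
(`y ≥ 0`, `T ≥ 1`). [cite: DuminilCopinHammond2013, §2.2; BeatonBousquetMelouDeGierDuminilCopinGuttmann2014, §3.2; lane «pcv-sawmu» a-p2 g22 — own] -/
theorem sum_betaLen_le_renewal (hT : 1 ≤ T) (hy : 0 ≤ y) {n : ℕ} (hN : n ≤ N + 1) :
    ∑ l ∈ betaLen T L n, hexCriticalFugacity ^ l.length * y ^ topCnt T l ≤
      2 * (∑ l ∈ (noRenA T L).filter (fun l => l.length = n), hexCriticalFugacity ^ l.length * y ^ topCnt T l +
        betaRenewalLenN T N N n y) := by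
  rw [sum_betaLen_eq_two_mul_caseA hT hy, sum_caseA_len_eq, sum_renA_len_eq_sum_rtypes hT, betaRenewalLenN_eq_sum_rtypes]
  have key : ∑ θ ∈ rtypes T n, renALen T L y θ ≤
      ∑ θ ∈ rtypes T n, headLenN T N θ.2.2.1 θ.1 y * hb0LenN T N θ.2.2.2.1 θ.1 θ.2.1 y * tailLenN T N θ.2.2.2.2 θ.2.1 y :=
    sum_le_sum fun θ hθ => by
      obtain ⟨c, e, i, j, k⟩ := θ
      rw [rtypes, mem_product, mem_product, mem_T3] at hθ
      exact renALen_le_prod hT hy c e (by simp only at hθ; omega)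
  linarith

/-- ★★ **THE LENGTH-GRADED RENEWAL SPLIT, LOWER HALF**: for `2N + N' ≤ L`,
`2·( Σ_{ω ∈ N₀^A(S_{T,L}), |ω| = n} x_c^{|ω|} y^{#top(ω)} + Σ_{c,e} Σ_{i+j+k=n} fℓ^{(N)}_c(i) dℓ^{(N')}_{ce}(j) gℓ^{(N)}_e(k) ) ≤ Σ_{betaLen T L n} x_c^{|ω|} y^{#top(ω)}`
(`y ≥ 0`, `T ≥ 1`). [cite: DuminilCopinHammond2013, §2.2; BeatonBousquetMelouDeGierDuminilCopinGuttmann2014, §3.2; lane «pcv-sawmu» a-p2 g22 — own] -/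
theorem renewal_le_sum_betaLen (hT : 1 ≤ T) (hy : 0 ≤ y) (hL : 2 * N + N' ≤ L) (n : ℕ) :
    2 * (∑ l ∈ (noRenA T L).filter (fun l => l.length = n), hexCriticalFugacity ^ l.length * y ^ topCnt T l +
        betaRenewalLenN T N N' n y) ≤ ∑ l ∈ betaLen T L n, hexCriticalFugacity ^ l.length * y ^ topCnt T l := by
  rw [sum_betaLen_eq_two_mul_caseA hT hy, sum_caseA_len_eq, sum_renA_len_eq_sum_rtypes hT, betaRenewalLenN_eq_sum_rtypes]
  have key : ∑ θ ∈ rtypes T n, headLenN T N θ.2.2.1 θ.1 y * hb0LenN T N' θ.2.2.2.1 θ.1 θ.2.1 y * tailLenN T N θ.2.2.2.2 θ.2.1 y ≤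
      ∑ θ ∈ rtypes T n, renALen T L y θ :=
    sum_le_sum fun θ _ => by
      obtain ⟨c, e, i, j, k⟩ := θ
      exact prod_le_renALen hT hy hL c e i j k
  linarith

end Summed

/-! ### §3 The slices do not depend on the truncations: the pieces and the β-walks of the infinite strip `S_T`, and the EXACT split -/

section Trunc

variable {L L' N N' : ℕ} {y : ℝ} {i j k n : ℕ}

/-- A head with `i` vertices lies in `headN T N c` for every `N + 1 ≥ i`: the length slice of the head class does not depend on the
truncation (plumbing). [cite: DuminilCopinHammond2013, §2.2; lane plumbing] -/
theorem filter_headN_length_eq_of_le (hi : i ≤ N + 1) (hi' : i ≤ N' + 1) (c : ℤ) :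
    (headN T N c).filter (fun h => h.length = i) = (headN T N' c).filter (fun h => h.length = i) := by
  ext h
  simp only [headN, mem_filter, mem_biUnion_stripChains_iff]
  constructor
  · rintro ⟨⟨⟨hc, hnd, hne, -, hh, hin⟩, rest⟩, hl⟩
    exact ⟨⟨⟨hc, hnd, hne, by omega, hh, hin⟩, rest⟩, hl⟩
  · rintro ⟨⟨⟨hc, hnd, hne, -, hh, hin⟩, rest⟩, hl⟩
    exact ⟨⟨⟨hc, hnd, hne, by omega, hh, hin⟩, rest⟩, hl⟩

/-- The same for the tails with `k` steps, `N ≥ k` (plumbing). [cite: DuminilCopinHammond2013, §2.2; lane plumbing] -/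
theorem filter_tailN_length_eq_of_le (hk : k ≤ N) (hk' : k ≤ N') (e : ℤ) :
    (tailN T N e).filter (fun g => g.length = k + 1) = (tailN T N' e).filter (fun g => g.length = k + 1) := by
  ext g
  simp only [tailN, mem_filter, mem_biUnion_stripChains_iff]
  constructor
  · rintro ⟨⟨⟨hc, hnd, hne, -, hh, hin⟩, rest⟩, hl⟩
    exact ⟨⟨⟨hc, hnd, hne, by omega, hh, hin⟩, rest⟩, hl⟩
  · rintro ⟨⟨⟨hc, hnd, hne, -, hh, hin⟩, rest⟩, hl⟩
    exact ⟨⟨⟨hc, hnd, hne, by omega, hh, hin⟩, rest⟩, hl⟩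

/-- The same for the middle pieces with `j` steps, `N ≥ j` (plumbing). [cite: DuminilCopinHammond2013, §2.2; lane plumbing] -/
theorem filter_HB0_length_eq_of_le (hj : j ≤ N) (hj' : j ≤ N') (c e : ℤ) :
    (HB0 T N c e).filter (fun b => b.length = j + 1) = (HB0 T N' c e).filter (fun b => b.length = j + 1) := by
  ext b
  simp only [HB0, mem_filter, mem_hBridgesN_iff]
  constructor
  · rintro ⟨⟨⟨hc, hnd, -, hh, hin, hB⟩, rest⟩, hl⟩
    exact ⟨⟨⟨hc, hnd, by omega, hh, hin, hB⟩, rest⟩, hl⟩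
  · rintro ⟨⟨⟨hc, hnd, -, hh, hin, hB⟩, rest⟩, hl⟩
    exact ⟨⟨⟨hc, hnd, by omega, hh, hin, hB⟩, rest⟩, hl⟩

/-- **The head pieces of the infinite strip by length**: `fℓ_c(i)(y) := fℓ^{(i)}_c(i)(y)` — ALL heads of `S_T` with `i` vertices ending on level `c`
(any truncation `N + 1 ≥ i` gives the same sum: `headLenN_eq_headLen`). [cite: DuminilCopinHammond2013, §2.2; BeatonBousquetMelouDeGierDuminilCopinGuttmann2014, §3.2; lane «pcv-sawmu» a-p2 g22] -/
def headLen (T i : ℕ) (c : ℤ) (y : ℝ) : ℝ := headLenN T i i c y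

/-- **The middle pieces of the infinite strip by length**: `dℓ_{ce}(j)(y) := dℓ^{(j)}_{ce}(j)(y)` — all standard horizontal bridges `c → e` of `S_T`
with `j` steps (the trivial bridge for `j = 0`). [cite: DuminilCopinHammond2013, §2.2; lane «pcv-sawmu» a-p2 g22] -/
def hb0Len (T j : ℕ) (c e : ℤ) (y : ℝ) : ℝ := hb0LenN T j j c e y

/-- **The tail pieces of the infinite strip by length**: `gℓ_e(k)(y) := gℓ^{(k)}_e(k)(y)` — all tails of `S_T` with `k` steps from level `e` to the top.
[cite: DuminilCopinHammond2013, §2.2; BeatonBousquetMelouDeGierDuminilCopinGuttmann2014, §3.2; lane «pcv-sawmu» a-p2 g22] -/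
def tailLen (T k : ℕ) (e : ℤ) (y : ℝ) : ℝ := tailLenN T k k e y

/-- `fℓ^{(N)}_c(i) = fℓ_c(i)` for `N + 1 ≥ i`. [cite: DuminilCopinHammond2013, §2.2; lane plumbing] -/
theorem headLenN_eq_headLen (hi : i ≤ N + 1) (c : ℤ) (y : ℝ) : headLenN T N i c y = headLen T i c y := by
  rw [headLen, headLenN, headLenN, filter_headN_length_eq_of_le (N' := i) hi (by omega)]

/-- `dℓ^{(N)}_{ce}(j) = dℓ_{ce}(j)` for `N ≥ j`. [cite: DuminilCopinHammond2013, §2.2; lane plumbing] -/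
theorem hb0LenN_eq_hb0Len (hj : j ≤ N) (c e : ℤ) (y : ℝ) : hb0LenN T N j c e y = hb0Len T j c e y := by
  rw [hb0Len, hb0LenN, hb0LenN, filter_HB0_length_eq_of_le hj le_rfl]

/-- `gℓ^{(N)}_e(k) = gℓ_e(k)` for `N ≥ k`. [cite: DuminilCopinHammond2013, §2.2; lane plumbing] -/
theorem tailLenN_eq_tailLen (hk : k ≤ N) (e : ℤ) (y : ℝ) : tailLenN T N k e y = tailLen T k e y := by
  rw [tailLen, tailLenN, tailLenN, filter_tailN_length_eq_of_le hk le_rfl]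

/-- Non-negativity of the length-graded pieces (`y ≥ 0`). [cite: DuminilCopinHammond2013, §2.2; lane plumbing] -/
theorem pieceLen_nonneg (hy : 0 ≤ y) (i : ℕ) (c e : ℤ) : 0 ≤ headLen T i c y ∧ 0 ≤ hb0Len T i c e y ∧ 0 ≤ tailLen T i e y :=
  ⟨sum_nonneg fun _ _ => mul_nonneg (pow_nonneg hexCriticalFugacity_pos_lt_one.1.le _) (pow_nonneg hy _),
    sum_nonneg fun _ _ => wD_nonneg T hy _, sum_nonneg fun _ _ => wD_nonneg T hy _⟩

/-- The β-walks with `n` vertices are the same in every box `S_{T,L}` with `L ≥ n` (box stability `SAW.mem_bridgeLists_of_length_le` of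
`HexSAWBridgeLength.lean`). [cite: DuminilCopinSmirnov2012, §3; lane plumbing] -/
theorem betaLen_eq_of_le (hT : 1 ≤ T) (hn : n ≤ L) (hn' : n ≤ L') : betaLen T L n = betaLen T L' n := by
  ext l
  simp only [betaLen, mem_filter]
  constructor
  · rintro ⟨hl, hlen⟩; exact ⟨mem_bridgeLists_of_length_le hT hl (by omega), hlen⟩
  · rintro ⟨hl, hlen⟩; exact ⟨mem_bridgeLists_of_length_le hT hl (by omega), hlen⟩

/-- The no-renewal case-A β-walks with `n` vertices are the same in every box `S_{T,L}` with `L ≥ n`. [cite: DuminilCopinHammond2013, §2.2; DuminilCopinSmirnov2012, §3; lane plumbing] -/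
theorem filter_noRenA_length_eq_of_le (hT : 1 ≤ T) (hn : n ≤ L) (hn' : n ≤ L') :
    (noRenA T L).filter (fun l => l.length = n) = (noRenA T L').filter (fun l => l.length = n) := by
  ext l
  simp only [noRenA, caseA, mem_filter]
  constructor
  · rintro ⟨⟨⟨hl, hst⟩, hren⟩, hlen⟩; exact ⟨⟨⟨mem_bridgeLists_of_length_le hT hl (by omega), hst⟩, hren⟩, hlen⟩
  · rintro ⟨⟨⟨hl, hst⟩, hren⟩, hlen⟩; exact ⟨⟨⟨mem_bridgeLists_of_length_le hT hl (by omega), hst⟩, hren⟩, hlen⟩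

/-- ★ **The β-walks of the infinite strip `S_T` with `n` vertices, weighted `x_c^{n} y^{#top}`**: `bℓ_T(n)(y) := Σ_{ω ∈ betaLen T n n} x_c^{|ω|} y^{#top(ω)}`
(every box `S_{T,L}` with `L ≥ n` contains all of them: `sum_betaLen_eq_betaLenSum`).  In print `Σ_n bℓ_T(n)(y) = B_T(x_c; y)`, the β-series of
the strip. [cite: BeatonBousquetMelouDeGierDuminilCopinGuttmann2014, §3.2 (B_T(x; y) = Σ_ω x^{|ω|} y^{#contacts}); DuminilCopinSmirnov2012, §3 (walks a → β); lane «pcv-sawmu» a-p2 g22] -/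
def betaLenSum (T n : ℕ) (y : ℝ) : ℝ := ∑ l ∈ betaLen T n n, hexCriticalFugacity ^ l.length * y ^ topCnt T l

/-- **The case-A β-walks of `S_T` with `n` vertices and NO renewal index, weighted**: `nℓ_T(n)(y)`. [cite: DuminilCopinHammond2013, §2.2 (renewal points); lane «pcv-sawmu» a-p2 g22] -/
def noRenLen (T n : ℕ) (y : ℝ) : ℝ :=
  ∑ l ∈ (noRenA T n).filter (fun l => l.length = n), hexCriticalFugacity ^ l.length * y ^ topCnt T l

/-- **The length-graded renewal sum of the infinite strip**: `Σ_{a,b} Σ_{i+j+k=n} fℓ_a(i) dℓ_{ab}(j) gℓ_b(k)` over the `2T` levels.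
[cite: DuminilCopinHammond2013, §2.2; lane «pcv-sawmu» a-p2 g22] -/
def betaRenewalLen (T n : ℕ) (y : ℝ) : ℝ :=
  ∑ a : Fin (2 * T), ∑ b : Fin (2 * T), ∑ t ∈ T3 n, headLen T t.1 (a : ℕ) y * hb0Len T t.2.1 (a : ℕ) (b : ℕ) y * tailLen T t.2.2 (b : ℕ) y

/-- `Σ_{betaLen T L n} = bℓ_T(n)` for every `L ≥ n`. [cite: DuminilCopinSmirnov2012, §3; lane plumbing] -/
theorem sum_betaLen_eq_betaLenSum (hT : 1 ≤ T) (hn : n ≤ L) (y : ℝ) :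
    ∑ l ∈ betaLen T L n, hexCriticalFugacity ^ l.length * y ^ topCnt T l = betaLenSum T n y := by
  rw [betaLenSum, betaLen_eq_of_le (L' := n) hT hn le_rfl]

/-- The no-renewal slice of every box `L ≥ n` is `nℓ_T(n)`. [cite: DuminilCopinHammond2013, §2.2; lane plumbing] -/
theorem sum_noRenA_len_eq_noRenLen (hT : 1 ≤ T) (hn : n ≤ L) (y : ℝ) :
    ∑ l ∈ (noRenA T L).filter (fun l => l.length = n), hexCriticalFugacity ^ l.length * y ^ topCnt T l = noRenLen T n y := by
  rw [noRenLen, filter_noRenA_length_eq_of_le (L' := n) hT hn le_rfl]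

/-- The truncated renewal sum is the renewal sum of the infinite strip as soon as `N, N' ≥ n`. [cite: DuminilCopinHammond2013, §2.2; lane plumbing] -/
theorem betaRenewalLenN_eq_betaRenewalLen (hN : n ≤ N) (hN' : n ≤ N') (y : ℝ) : betaRenewalLenN T N N' n y = betaRenewalLen T n y := by
  rw [betaRenewalLenN, betaRenewalLen, sum_Icc_levels_eq_sum_fin]
  refine sum_congr rfl fun a _ => ?_
  rw [sum_Icc_levels_eq_sum_fin]
  refine sum_congr rfl fun b _ => sum_congr rfl fun t ht => ?_
  rw [mem_T3] at ht
  rw [headLenN_eq_headLen (by omega), hb0LenN_eq_hb0Len (by omega), tailLenN_eq_tailLen (by omega)]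

/-- Non-negativity of `bℓ_T(n)`, `nℓ_T(n)` and the renewal sum (`y ≥ 0`). [cite: BeatonBousquetMelouDeGierDuminilCopinGuttmann2014, §3.2; lane plumbing] -/
theorem betaLenSum_noRenLen_nonneg (hy : 0 ≤ y) (n : ℕ) : 0 ≤ betaLenSum T n y ∧ 0 ≤ noRenLen T n y ∧ 0 ≤ betaRenewalLen T n y := by
  refine ⟨sum_nonneg fun _ _ => mul_nonneg (pow_nonneg hexCriticalFugacity_pos_lt_one.1.le _) (pow_nonneg hy _),
    sum_nonneg fun _ _ => mul_nonneg (pow_nonneg hexCriticalFugacity_pos_lt_one.1.le _) (pow_nonneg hy _),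
    sum_nonneg fun a _ => sum_nonneg fun b _ => sum_nonneg fun t _ => ?_⟩
  obtain ⟨h1, -, -⟩ := pieceLen_nonneg hy t.1 (a : ℤ) (b : ℤ) (T := T)
  obtain ⟨-, h2, -⟩ := pieceLen_nonneg hy t.2.1 (a : ℤ) (b : ℤ) (T := T)
  obtain ⟨-, -, h3⟩ := pieceLen_nonneg hy t.2.2 (a : ℤ) (b : ℤ) (T := T)
  exact mul_nonneg (mul_nonneg h1 h2) h3

/-- ★★★ **THE EXACT RENEWAL SPLIT OF THE β-WALKS OF `S_T` BY LENGTH**: for every `n`, every `y ≥ 0` and every width `T ≥ 1`,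
`bℓ_T(n)(y) = 2·( nℓ_T(n)(y) + Σ_{a,b} Σ_{i+j+k=n} fℓ_a(i)(y) dℓ_{ab}(j)(y) gℓ_b(k)(y) )` — the β-walks with `n` vertices are, up to the mirror
(factor `2`), the case-A walks without renewal point plus the glued triples head ⊕ bridge ⊕ tail of total length `n`, bijectively.
[cite: DuminilCopinHammond2013, §2.2 (unique decomposition at renewal points); DuminilCopinSmirnov2012, §3; BeatonBousquetMelouDeGierDuminilCopinGuttmann2014, §3.2; lane «pcv-sawmu» a-p2 g22 — own] -/
theorem betaLenSum_eq_two_mul (hT : 1 ≤ T) (hy : 0 ≤ y) (n : ℕ) :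
    betaLenSum T n y = 2 * (noRenLen T n y + betaRenewalLen T n y) := by
  have hup := sum_betaLen_le_renewal hT hy (L := 3 * n) (N := n) (n := n) (by omega) (T := T) (y := y)
  have hlo := renewal_le_sum_betaLen hT hy (L := 3 * n) (N := n) (N' := n) (by omega) n (T := T) (y := y)
  rw [sum_betaLen_eq_betaLenSum hT (by omega), sum_noRenA_len_eq_noRenLen hT (by omega),
    betaRenewalLenN_eq_betaRenewalLen le_rfl le_rfl] at hup hlo
  linarith

end Trunc

/-! ### §4 The middle pieces are the length slices of the bridge files; the trivial bridge -/

section Middle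

variable {y : ℝ} {j : ℕ}

/-- ★ For `j ≥ 1` the middle pieces with `j` steps are exactly the length slice `LUset T j j` of «LENGTH-POINTWISE»: `dℓ_{ce}(j)(y) = U_j(c,e)(y)`
(`= LUM T j j y` on the levels). [cite: DuminilCopinHammond2013, §2.2 (bridges); lane plumbing] -/
theorem hb0Len_eq_LUs (hj : 1 ≤ j) (c e : ℤ) (y : ℝ) : hb0Len T j c e y = LUs T j (j : ℤ) c e y := by
  rw [hb0Len, hb0LenN, LUs]
  refine sum_congr ?_ fun _ _ => rfl
  ext b
  simp only [HB0, LUset, HBab, mem_filter, hlen]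
  constructor
  · rintro ⟨⟨hB, hd, hl⟩, hlen⟩
    exact ⟨⟨hB, by omega, hd, hl⟩, by rw [hlen]; push_cast; ring⟩
  · rintro ⟨⟨hB, -, hd, hl⟩, hlen⟩
    exact ⟨⟨hB, hd, hl⟩, by have := hlen; omega⟩

/-- On the levels: `dℓ_{ab}(j)(y) = LUM T j j y a b` for `j ≥ 1`. [cite: DuminilCopinHammond2013, §2.2; lane plumbing] -/
theorem hb0Len_eq_LUM (hj : 1 ≤ j) (y : ℝ) (a b : Fin (2 * T)) : hb0Len T j (a : ℕ) (b : ℕ) y = LUM T j (j : ℤ) y a b := by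
  rw [LUM, hb0Len_eq_LUs hj]

/-- The trivial slice is bounded by the (finite) one-vertex class: `dℓ_{ce}(0)(y) ≤ Σ_{hBridgesN T 0} wD` (`y ≥ 0`; plumbing).
[cite: DuminilCopinHammond2013, §2.2; lane plumbing] -/
theorem hb0Len_zero_le (hy : 0 ≤ y) (c e : ℤ) : hb0Len T 0 c e y ≤ ∑ l ∈ hBridgesN T 0, wD T y l := by
  rw [hb0Len, hb0LenN]
  refine sum_le_sum_of_subset_of_nonneg (fun b hb => ?_) fun _ _ _ => wD_nonneg T hy _
  rw [mem_filter, HB0, mem_filter] at hb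
  exact hb.1.1

/-- ★ **The middle slices are bounded at the threshold, uniformly in the length**: `∃ K, ∀ j a b, dℓ_{ab}(j)(y_T) ≤ K` (`T ≥ 1`; from
`HV.exists_LUs_stripYT_le` for `j ≥ 1`). [cite: DuminilCopinHammond2013, §2.2; BeatonBousquetMelouDeGierDuminilCopinGuttmann2014, Corollary 8 (y_T); lane «pcv-sawmu» a-p2 g17/g22] -/
theorem exists_hb0Len_stripYT_le (hT : 1 ≤ T) :
    ∃ K : ℝ, ∀ (j : ℕ) (a b : Fin (2 * T)), hb0Len T j (a : ℕ) (b : ℕ) (stripYT T) ≤ K := by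
  obtain ⟨K₁, hK₁⟩ := exists_LUs_stripYT_le hT
  have hy : 0 ≤ stripYT T := (one_lt_stripYT hT).le.trans' zero_le_one
  refine ⟨max K₁ (∑ l ∈ hBridgesN T 0, wD T (stripYT T) l), fun j a b => ?_⟩
  rcases Nat.eq_zero_or_pos j with rfl | hj
  · exact (hb0Len_zero_le hy _ _).trans (le_max_right _ _)
  · rw [hb0Len_eq_LUs hj]
    exact (hK₁ j j a b).trans (le_max_left _ _)

end Middle

/-! ### §5 At the threshold `y_T`: the head and tail pieces are summable over the length, the no-renewal walks die out -/

section Threshold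

variable {y : ℝ}

/-- Summing the head slices over the lengths `≤ N + 1` gives the truncated head series `F^{(N)}_c(y)` of «BETA-COEFF».
[cite: DuminilCopinHammond2013, §2.2; BeatonBousquetMelouDeGierDuminilCopinGuttmann2014, §3.2; lane plumbing] -/
theorem sum_range_headLen_eq_headGFN (N : ℕ) (c : ℤ) (y : ℝ) :
    ∑ i ∈ Finset.range (N + 2), headLen T i c y = headGFN T N c y := by
  classical
  rw [headGFN, ← Finset.sum_fiberwise_of_maps_to (g := List.length) (t := Finset.range (N + 2)) (fun h hh => by
    obtain ⟨-, -, hlen, -⟩ := of_mem_headN hh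
    rw [mem_range]; omega)]
  refine sum_congr rfl fun i hi => ?_
  rw [mem_range] at hi
  rw [← headLenN_eq_headLen (N := N) (by omega), headLenN]

/-- Summing the tail slices over the steps `≤ N` gives the truncated tail series `G^{(N)}_e(y)` of «BETA-COEFF».
[cite: DuminilCopinHammond2013, §2.2; BeatonBousquetMelouDeGierDuminilCopinGuttmann2014, §3.2; lane plumbing] -/
theorem sum_range_tailLen_eq_tailGFN (N : ℕ) (e : ℤ) (y : ℝ) :
    ∑ k ∈ Finset.range (N + 1), tailLen T k e y = tailGFN T N e y := by
  classical
  rw [tailGFN, ← Finset.sum_fiberwise_of_maps_to (g := fun g : List HV => g.length - 1) (t := Finset.range (N + 1)) (fun g hg => by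
    obtain ⟨-, -, hlen, -⟩ := of_mem_tailN hg
    rw [mem_range]; omega)]
  refine sum_congr rfl fun k hk => ?_
  rw [mem_range] at hk
  rw [← tailLenN_eq_tailLen (N := N) (by omega), tailLenN]
  refine sum_congr (filter_congr fun g hg => ?_) fun _ _ => rfl
  obtain ⟨-, -, -, -, -, h2, -⟩ := of_mem_tailN hg
  omega

/-- Summing the no-renewal slices over the lengths `≤ M` stays below the no-renewal class of the box `S_{T,M}` (`y ≥ 0`).
[cite: DuminilCopinHammond2013, §2.2; lane plumbing] -/
theorem sum_range_noRenLen_le (hT : 1 ≤ T) (hy : 0 ≤ y) (M : ℕ) :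
    ∑ n ∈ Finset.range (M + 1), noRenLen T n y ≤ ∑ l ∈ noRenA T M, hexCriticalFugacity ^ l.length * y ^ topCnt T l := by
  classical
  set S := (noRenA T M).filter (fun l => l.length < M + 1) with hS
  have h1 : ∑ n ∈ Finset.range (M + 1), noRenLen T n y = ∑ l ∈ S, hexCriticalFugacity ^ l.length * y ^ topCnt T l := by
    rw [← Finset.sum_fiberwise_of_maps_to (g := List.length) (t := Finset.range (M + 1)) (s := S) (fun l hl => by
      rw [hS, mem_filter] at hl; exact mem_range.2 hl.2)]
    refine sum_congr rfl fun n hn => ?_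
    rw [mem_range] at hn
    rw [← sum_noRenA_len_eq_noRenLen hT (L := M) (by omega), hS, filter_filter]
    refine sum_congr (filter_congr fun l _ => ⟨fun h => ⟨by omega, h⟩, fun h => h.2⟩) fun _ _ => rfl
  rw [h1]
  exact sum_le_sum_of_subset_of_nonneg (filter_subset _ _)
    fun _ _ _ => mul_nonneg (pow_nonneg hexCriticalFugacity_pos_lt_one.1.le _) (pow_nonneg hy _)

/-- ★★ **The head pieces are summable over the length at the threshold**: `Σ_i fℓ_c(i)(y_T) < ∞` for every level `c` (`T ≥ 2`; the partial sums are
the truncated head series, bounded at `y_T` by «BETA-COEFF» §4). [cite: BeatonBousquetMelouDeGierDuminilCopinGuttmann2014, Corollary 8 (y_T); lane «pcv-sawmu» a-p2 g21/g22 — own] -/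
theorem summable_headLen (hT : 2 ≤ T) (c : ℤ) : Summable (fun i => headLen T i c (stripYT T)) := by
  obtain ⟨A, hA⟩ := exists_headGFN_stripYT_le hT c
  have hy : 0 ≤ stripYT T := (one_lt_stripYT (by omega : 1 ≤ T)).le.trans' zero_le_one
  refine summable_of_sum_range_le (c := A) (fun i => (pieceLen_nonneg hy i c c).1) fun n => ?_
  calc ∑ i ∈ Finset.range n, headLen T i c (stripYT T) ≤ ∑ i ∈ Finset.range (n + 2), headLen T i c (stripYT T) :=
        sum_le_sum_of_subset_of_nonneg (range_subset_range.2 (by omega)) fun i _ _ => (pieceLen_nonneg hy i c c).1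
    _ = headGFN T n c (stripYT T) := sum_range_headLen_eq_headGFN n c _
    _ ≤ A := hA n

/-- ★★ **The tail pieces are summable over the length at the threshold**: `Σ_k gℓ_e(k)(y_T) < ∞` (`T ≥ 2`). [cite: BeatonBousquetMelouDeGierDuminilCopinGuttmann2014, Corollary 8 (y_T); lane «pcv-sawmu» a-p2 g21/g22 — own] -/
theorem summable_tailLen (hT : 2 ≤ T) (e : ℤ) : Summable (fun k => tailLen T k e (stripYT T)) := by
  obtain ⟨A, hA⟩ := exists_tailGFN_stripYT_le hT e
  have hy : 0 ≤ stripYT T := (one_lt_stripYT (by omega : 1 ≤ T)).le.trans' zero_le_one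
  refine summable_of_sum_range_le (c := A) (fun k => (pieceLen_nonneg hy k e e).2.2) fun n => ?_
  calc ∑ k ∈ Finset.range n, tailLen T k e (stripYT T) ≤ ∑ k ∈ Finset.range (n + 1), tailLen T k e (stripYT T) :=
        sum_le_sum_of_subset_of_nonneg (range_subset_range.2 (by omega)) fun k _ _ => (pieceLen_nonneg hy k e e).2.2
    _ = tailGFN T n e (stripYT T) := sum_range_tailLen_eq_tailGFN n e _
    _ ≤ A := hA n

/-- ★★ **The no-renewal β-walks are summable over the length at the threshold** (`T ≥ 2`; «BETA-NORENEWAL»), hence `nℓ_T(n)(y_T) → 0`.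
[cite: DuminilCopinHammond2013, §2.2; BeatonBousquetMelouDeGierDuminilCopinGuttmann2014, Corollary 8; lane «pcv-sawmu» a-p2 g20/g22 — own] -/
theorem summable_noRenLen (hT : 2 ≤ T) : Summable (fun n => noRenLen T n (stripYT T)) := by
  have hT1 : 1 ≤ T := by omega
  obtain ⟨C, hC⟩ := exists_sum_noRenA_stripYT_le hT
  have hy : 0 ≤ stripYT T := (one_lt_stripYT hT1).le.trans' zero_le_one
  refine summable_of_sum_range_le (c := C) (fun n => (betaLenSum_noRenLen_nonneg hy n).2.1) fun n => ?_
  calc ∑ m ∈ Finset.range n, noRenLen T m (stripYT T) ≤ ∑ m ∈ Finset.range (n + 1), noRenLen T m (stripYT T) :=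
        sum_le_sum_of_subset_of_nonneg (range_subset_range.2 (by omega)) fun m _ _ => (betaLenSum_noRenLen_nonneg hy m).2.1
    _ ≤ _ := sum_range_noRenLen_le hT1 hy n
    _ ≤ C := hC n

/-- `nℓ_T(n)(y_T) → 0`: the walks without renewal point do not contribute to long β-walks at the threshold (`T ≥ 2`).
[cite: DuminilCopinHammond2013, §2.2; lane «pcv-sawmu» a-p2 g22 — own] -/
theorem tendsto_noRenLen_atTop (hT : 2 ≤ T) : Tendsto (fun n => noRenLen T n (stripYT T)) atTop (𝓝 0) :=
  (summable_noRenLen hT).tendsto_atTop_zero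

/-- **The head series of the infinite strip at the threshold, summed over the length**: `Fℓ_c := Σ_i fℓ_c(i)(y_T)` (the total
`x_c^{|h|} y_T^{#top}`-mass of the heads of `S_T` ending on level `c`). [cite: BeatonBousquetMelouDeGierDuminilCopinGuttmann2014, §3.2; lane «pcv-sawmu» a-p2 g22] -/
def headLenGF (T : ℕ) (c : ℤ) : ℝ := ∑' i, headLen T i c (stripYT T)

/-- **The tail series of the infinite strip at the threshold, summed over the length**: `Gℓ_e := Σ_k gℓ_e(k)(y_T)`.
[cite: BeatonBousquetMelouDeGierDuminilCopinGuttmann2014, §3.2; lane «pcv-sawmu» a-p2 g22] -/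
def tailLenGF (T : ℕ) (e : ℤ) : ℝ := ∑' k, tailLen T k e (stripYT T)

/-- ★ The truncated head series converge to `Fℓ_c`: `F^{(N)}_c(y_T) → Fℓ_c` as `N → ∞` (`T ≥ 2`). [cite: BeatonBousquetMelouDeGierDuminilCopinGuttmann2014, §3.2; lane «pcv-sawmu» a-p2 g22 — own] -/
theorem tendsto_headGFN_headLenGF (hT : 2 ≤ T) (c : ℤ) : Tendsto (fun N => headGFN T N c (stripYT T)) atTop (𝓝 (headLenGF T c)) := by
  have h := ((summable_headLen hT c).hasSum.tendsto_sum_nat).comp (tendsto_add_atTop_nat 2)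
  refine h.congr fun N => ?_
  simp only [Function.comp_def]
  exact sum_range_headLen_eq_headGFN N c _

/-- ★ The truncated tail series converge to `Gℓ_e`: `G^{(N)}_e(y_T) → Gℓ_e` (`T ≥ 2`). [cite: BeatonBousquetMelouDeGierDuminilCopinGuttmann2014, §3.2; lane «pcv-sawmu» a-p2 g22 — own] -/
theorem tendsto_tailGFN_tailLenGF (hT : 2 ≤ T) (e : ℤ) : Tendsto (fun N => tailGFN T N e (stripYT T)) atTop (𝓝 (tailLenGF T e)) := by
  have h := ((summable_tailLen hT e).hasSum.tendsto_sum_nat).comp (tendsto_add_atTop_nat 1)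
  refine h.congr fun N => ?_
  simp only [Function.comp_def]
  exact sum_range_tailLen_eq_tailGFN N e _

/-- `F^{(N)}_c(y_T) ≤ Fℓ_c` and `G^{(N)}_e(y_T) ≤ Gℓ_e`; both limits are `≥ 0` (`T ≥ 2`). [cite: BeatonBousquetMelouDeGierDuminilCopinGuttmann2014, §3.2; lane plumbing] -/
theorem headGFN_le_headLenGF (hT : 2 ≤ T) (N : ℕ) (c e : ℤ) :
    headGFN T N c (stripYT T) ≤ headLenGF T c ∧ tailGFN T N e (stripYT T) ≤ tailLenGF T e ∧ 0 ≤ headLenGF T c ∧ 0 ≤ tailLenGF T e := by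
  have hy : 0 ≤ stripYT T := (one_lt_stripYT (by omega : 1 ≤ T)).le.trans' zero_le_one
  refine ⟨?_, ?_, tsum_nonneg fun i => (pieceLen_nonneg hy i c c).1, tsum_nonneg fun k => (pieceLen_nonneg hy k e e).2.2⟩
  · rw [← sum_range_headLen_eq_headGFN]
    exact (summable_headLen hT c).sum_le_tsum _ fun i _ => (pieceLen_nonneg hy i c c).1
  · rw [← sum_range_tailLen_eq_tailGFN]
    exact (summable_tailLen hT e).sum_le_tsum _ fun k _ => (pieceLen_nonneg hy k e e).2.2

/-- ★ `Fℓ_1 > 0` (the head `O → (0,0,↓)`) and `Gℓ_{2T−2} > 0` (the last step onto the wall) (`T ≥ 2`). [cite: DuminilCopinSmirnov2012, §3 (Fig. 3); BeatonBousquetMelouDeGierDuminilCopinGuttmann2014, §3.2; lane «pcv-sawmu» a-p2 g21/g22] -/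
theorem headLenGF_one_pos (hT : 2 ≤ T) : 0 < headLenGF T 1 ∧ 0 < tailLenGF T (2 * (T : ℤ) - 2) := by
  have hT1 : 1 ≤ T := by omega
  have hx := hexCriticalFugacity_pos_lt_one
  have h1 := one_lt_stripYT hT1
  obtain ⟨hF, -, -, -⟩ := headGFN_le_headLenGF hT 1 1 1
  obtain ⟨-, hG, -, -⟩ := headGFN_le_headLenGF hT 1 1 (2 * (T : ℤ) - 2)
  exact ⟨lt_of_lt_of_le (pow_pos hx.1 2) ((sq_le_headGFN_one hT1 le_rfl h1.le).trans hF),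
    lt_of_lt_of_le (mul_pos hx.1 (by linarith)) ((mul_le_tailGFN_top hT1 le_rfl (by linarith)).trans hG)⟩

end Threshold

end HV

end Literature.Probability.RandomPlanarGeometry.SAW
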